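import Summits.SmoothPoincare4.SmoothPoincare4.Theorems.EntropyRungBakryEmeryLogSobolevVeryWeak
import Summits.SmoothPoincare4.SmoothPoincare4.Theorems.EntropyRungBakryEmeryLogSobolevSchrodingerCoercivity
import Summits.SmoothPoincare4.SmoothPoincare4.Theorems.EntropyRungBakryEmeryLogSobolevStampacchia
import Summits.SmoothPoincare4.SmoothPoincare4.Theorems.EntropyRungNoncompactShrinkerGapHeatLinearHeat
import HarnessLib

/-!
# The forced ground-state transformed heat problem on a complete weighted manifold with ARBITRARY smooth
# weight: smooth solutions vanishing for `s ≤ 0`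
# (support item `EntropyRung.BakryEmeryLogSobolev`, stmt-SmoothPoincare4-16587)

Setting: `M` modelled on `ℝⁿ` (Hausdorff, second countable, `T₃`, Borel — NOT compact), `g` Riemannian with
its Levi-Civita connection, `V` smooth (NO further assumption), the ground-state potential
`Q = ¼|∇V|² − ½Δ_gV + 1` (unbounded below in general), and Gaffney cut-offs `η_k` (`0 ≤ η_k ≤ 1`,
`η_k ≤ η_{k+1}`, `η_k(x) = 1` for large `k`, `|∇η_k|² ≤ C₀/(k+1)²`, `exists_gaffney_cutoff`).

* `exists_smooth_schrodingerHeat_forcing` — for `G` smooth with compact support in `M × ℝ` and `G = 0` for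
  `s ≤ 0`, there is `v` smooth on `M × (−∞, b)` with `v = 0` for `s ≤ 0`, `∂ₛv = Δ_g v − Qv + G` on
  `M × (−∞, b)` and `v² ∈ L¹(M × (0, b))`. This is the shrinker toolkit's
  `exists_smooth_linearHeat_forcing_static` (`EntropyRungNoncompactShrinkerGapHeatLinearHeat.lean`, crux
  `EntropyRung.NoncompactShrinkerGap`; Trèves 1975, §41) with its two uses of `Q ≥ 1` / Laplacian cut-offs
  replaced: Lions' very weak solution now comes from the perfect-square energy inequality
  (`exists_veryWeak_linearHeat_of_energyIneq` + `energy_le_integral_mul_schrodingerAdjoint`), and the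
  vanishing on `[−3, 0]` from the weighted `L²` maximum principle with FIRST-ORDER cut-offs
  (`gaffney_maxPrinciple`) applied to `± e^{V/2} e^{s} v(·, s − 3)`, a solution of the weighted heat equation
  `∂ₛz = Lz` (`heatDrift_of_potential`); hypoellipticity (`helper_hypoelliptic_noncompact`) and the
  classical equation (`helper_classicalOfVeryWeak_noncompact`) are the toolkit's, unchanged;
* `linearHeat_cauchy_gaffney` — the linear Cauchy problem `∂ₛw = Δ_g w − Qw`, `w(0) = W(0)` for
  flat-corrector data `(W, G, K)` (as produced by `helper_flatCorrector_noncompact`): a solution smooth on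
  `M × (−∞, T+1)`, square integrable on `M × (0, T)` — `helper_linearHeat_noncompact` in this setting.

Everything is proved; no definitions, no named facts.

## References

* [Treves1975] F. Trèves, *Basic Linear Partial Differential Equations* (1975), §41, Thm. 40.1.
* [Grigoryan2009] A. Grigor'yan (2009), Ch. 7–8 and §11.4 (uniqueness class of the Cauchy problem).
* [BakryGentilLedoux2014] D. Bakry, I. Gentil, M. Ledoux (2014), §3.2 (pp. 141–147).
-/

noncomputable section

set_option linter.dupNamespace false

open scoped Manifold ContDiff ENNReal NNReal Topology
open MeasureTheory Set Filter
open Literature.Geometry.Lorentzian Literature.Geometry.Riemannian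
open Literature.Geometry.Lorentzian.PseudoRiemannianMetric (laplaceBeltrami_eq_dalembertian)

namespace Summit.SmoothPoincare4.SmoothPoincare4.Theorems.BakryEmeryComplete

open NoncompactShrinkerGapHeat

/-- **Time translation of strip integrability**: if `F` is integrable on `M × (a, b')` for `μ ⊗ ds`, then
`(x, r) ↦ F (x, r − c)` is integrable on `M × (a + c, b' + c)` (Lebesgue measure is translation invariant;
`MeasurePreserving.integrableOn_comp_preimage` for the shear `Prod.map id (· − c)`). [folklore] -/
theorem integrable_strip_comp_sub {X : Type*} [MeasurableSpace X] (μ : Measure X) [SFinite μ] {F : X × ℝ → ℝ}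
    {a b' : ℝ} (c : ℝ)
    (hF : Integrable F ((μ.prod (volume : Measure ℝ)).restrict (univ ×ˢ Ioo a b'))) :
    Integrable (fun p : X × ℝ ↦ F (p.1, p.2 - c))
      ((μ.prod (volume : Measure ℝ)).restrict (univ ×ˢ Ioo (a + c) (b' + c))) := by
  have hmp : MeasurePreserving (Prod.map (id : X → X) (fun t : ℝ ↦ t - c))
      (μ.prod (volume : Measure ℝ)) (μ.prod (volume : Measure ℝ)) :=
    (MeasurePreserving.id μ).prod (measurePreserving_sub_right volume c)
  have hme : MeasurableEmbedding (Prod.map (id : X → X) (fun t : ℝ ↦ t - c)) :=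
    ((MeasurableEquiv.refl X).prodCongr (MeasurableEquiv.subRight c)).measurableEmbedding
  have hpre : (Prod.map (id : X → X) (fun t : ℝ ↦ t - c)) ⁻¹' (univ ×ˢ Ioo a b') =
      (univ : Set X) ×ˢ Ioo (a + c) (b' + c) := by
    ext ⟨x, t⟩
    simp only [mem_preimage, Prod.map_apply, id_eq, mem_prod, mem_univ, true_and, mem_Ioo]
    constructor <;> rintro ⟨h1, h2⟩ <;> constructor <;> linarith
  have h := (hmp.integrableOn_comp_preimage hme (f := F) (s := univ ×ˢ Ioo a b')).2 hF
  rw [hpre] at h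
  exact h

section Forcing

variable {n : ℕ} {M : Type*} [TopologicalSpace M] [T2Space M] [SecondCountableTopology M]
  [ChartedSpace (EuclideanSpace ℝ (Fin n)) M] [IsManifold (𝓡 n) ∞ M] [T3Space M] [MeasurableSpace M]
  [BorelSpace M]
  {g : PseudoRiemannianMetric (𝓡 n) ∞ (EuclideanSpace ℝ (Fin n)) (TangentSpace (𝓡 n) : M → Type _)}
  [g.HasLeviCivita]

/-- **The forced problem for the ground-state transformed operator on a complete weighted manifold with
arbitrary smooth weight** (see the module docstring): for `Q = ¼|∇V|² − ½ΔV + 1`, `G` smooth with compact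
support and `G = 0` for `s ≤ 0`, there is `v` smooth on `M × (−∞, b)`, `v = 0` for `s ≤ 0`,
`∂ₛv = Δ_g v − Qv + G` on `M × (−∞, b)`, `v² ∈ L¹(M × (0, b))`. [cite: Treves1975, §41, Thm. 40.1]
[cite: Grigoryan2009, §11.4] -/
theorem exists_smooth_schrodingerHeat_forcing (hg : g.IsRiemannian) {V : M → ℝ}
    (hV : ContMDiff (𝓡 n) 𝓘(ℝ, ℝ) ∞ V)
    {η : ℕ → M → ℝ} {C₀ : ℝ} (hηs : ∀ k, ContMDiff (𝓡 n) 𝓘(ℝ, ℝ) ∞ (η k))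
    (hηc : ∀ k, HasCompactSupport (η k)) (hη01 : ∀ k x, 0 ≤ η k x ∧ η k x ≤ 1)
    (hηmono : ∀ k x, η k x ≤ η (k + 1) x) (hη1 : ∀ x, ∀ᶠ k in atTop, η k x = 1)
    (hηgrad : ∀ k x, g.gradSq (η k) x ≤ C₀ / ((k : ℝ) + 1) ^ 2)
    {G : ℝ → M → ℝ} (hG : ContMDiff ((𝓡 n).prod 𝓘(ℝ, ℝ)) 𝓘(ℝ, ℝ) ∞ (fun p : M × ℝ ↦ G p.2 p.1))
    (hGc : HasCompactSupport (fun p : M × ℝ ↦ G p.2 p.1)) (hG0 : ∀ s ≤ (0 : ℝ), ∀ x, G s x = 0)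
    {b : ℝ} (hb : 0 < b) :
    ∃ v : M × ℝ → ℝ, ContMDiffOn ((𝓡 n).prod 𝓘(ℝ, ℝ)) 𝓘(ℝ, ℝ) ∞ v (univ ×ˢ Iio b) ∧
      (∀ x, ∀ s ≤ (0 : ℝ), v (x, s) = 0) ∧
      (∀ x, ∀ s < b, deriv (fun r ↦ v (x, r)) s =
        g.laplaceBeltrami (fun y ↦ v (y, s)) x - (g.gradSq V x / 4 - g.dalembertian V x / 2 + 1) * v (x, s)
          + G s x) ∧
      Integrable (fun p : M × ℝ ↦ v p ^ 2) ((g.riemVolume.prod (volume : Measure ℝ)).restrict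
        (univ ×ˢ Ioo 0 b)) := by
  classical
  haveI : LocallyCompactSpace M := ChartedSpace.locallyCompactSpace (EuclideanSpace ℝ (Fin n)) M
  haveI := CarrilloNi2009_shrinkerLSI.isFiniteMeasureOnCompacts_riemVolume hg
  set μ₀ : Measure M := g.riemVolume with hμ₀
  haveI : μ₀.IsOpenPosMeasure := CutoffToolkit.isOpenPosMeasure_riemVolume hg
  haveI : (μ₀.prod (volume : Measure ℝ)).IsOpenPosMeasure := Measure.prod.instIsOpenPosMeasure
  haveI : SigmaFinite μ₀ := CutoffToolkit.sigmaFinite_riemVolume hg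
  have hab : (-2 : ℝ) < b := by linarith
  -- the potential (time independent, smooth)
  set Q : ℝ → M → ℝ := fun _ x ↦ g.gradSq V x / 4 - g.dalembertian V x / 2 + 1 with hQdef
  have hQ : ContMDiff ((𝓡 n).prod 𝓘(ℝ, ℝ)) 𝓘(ℝ, ℝ) ∞ (fun p : M × ℝ ↦ Q p.2 p.1) := by
    have h1 : ContMDiff (𝓡 n) 𝓘(ℝ, ℝ) ∞ (fun x ↦ g.gradSq V x / 4 - g.dalembertian V x / 2 + 1) :=
      (((contMDiff_gradSq g hV).div_const 4).sub ((contMDiff_dalembertian g hV).div_const 2)).add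
        contMDiff_const
    exact h1.comp contMDiff_fst
  -- Lions' very weak solution on `M × (-2, b)` (perfect-square coercivity), extended by zero
  obtain ⟨u, hum, hu2, hu0, huweak⟩ := exists_veryWeak_linearHeat_of_energyIneq hg (Q := Q) hQ hG hGc
    (a := -2) (b := b) (fun K φ hK hφ hφK hφb ↦ energy_le_integral_mul_schrodingerAdjoint hg hV hab hK hφ hφK hφb)
  -- it is a very weak solution on `M × (-∞, b)` (the forcing vanishes for `s ≤ 0`)
  have huweak' : ∀ ζ : M × ℝ → ℝ, ContMDiff ((𝓡 n).prod 𝓘(ℝ, ℝ)) 𝓘(ℝ, ℝ) ∞ ζ → HasCompactSupport ζ →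
      tsupport ζ ⊆ univ ×ˢ Iio b →
      ∫ p, u p * (-(deriv (fun s ↦ ζ (p.1, s)) p.2) - g.laplaceBeltrami (fun x ↦ ζ (x, p.2)) p.1 +
          Q p.2 p.1 * ζ p) ∂μ₀.prod (volume : Measure ℝ) =
        ∫ p, G p.2 p.1 * ζ p ∂μ₀.prod (volume : Measure ℝ) := by
    intro ζ hζ hζc hζb
    rw [huweak ζ hζ hζc hζb]
    refine setIntegral_eq_integral_of_forall_compl_eq_zero fun p hp ↦ ?_
    by_cases hpb : p.2 < b
    · have hpa : p.2 ≤ -2 := by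
        by_contra h'
        exact hp ⟨mem_univ _, not_le.1 h', hpb⟩
      rw [hG0 p.2 (by linarith) p.1, zero_mul]
    · have hp' : p ∉ tsupport ζ := fun h' ↦ hpb (hζb h').2
      rw [image_eq_zero_of_notMem_tsupport hp', mul_zero]
  -- interior regularity on the open time set `(-∞, b)`
  have hu1 : LocallyIntegrableOn u (univ ×ˢ Iio b) (μ₀.prod (volume : Measure ℝ)) :=
    (hu2.locallyIntegrable (by norm_num)).locallyIntegrableOn _
  obtain ⟨v, hv, hae⟩ := helper_hypoelliptic_noncompact n M g hg Q G hQ hG (Iio b) u isOpen_Iio hum hu1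
    huweak'
  -- the weak identity for the smooth representative
  have hvweak : ∀ ζ : M × ℝ → ℝ, ContMDiff ((𝓡 n).prod 𝓘(ℝ, ℝ)) 𝓘(ℝ, ℝ) ∞ ζ → HasCompactSupport ζ →
      tsupport ζ ⊆ univ ×ˢ Iio b →
      ∫ p, v p * (-(deriv (fun s ↦ ζ (p.1, s)) p.2) - g.laplaceBeltrami (fun x ↦ ζ (x, p.2)) p.1 +
          Q p.2 p.1 * ζ p) ∂μ₀.prod (volume : Measure ℝ) =
        ∫ p, G p.2 p.1 * ζ p ∂μ₀.prod (volume : Measure ℝ) := by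
    intro ζ hζ hζc hζb
    rw [← huweak' ζ hζ hζc hζb]
    refine integral_congr_ae ?_
    filter_upwards [hae] with p hp
    by_cases hpz : p ∈ tsupport ζ
    · rw [hp (hζb hpz)]
    · simp only [staticHeatAdjoint_eq_zero_of_notMem_tsupport Q hpz, mul_zero]
  -- the classical equation on `M × (-∞, b)`
  have hclass : ∀ x, ∀ s < b, deriv (fun r ↦ v (x, r)) s =
      g.laplaceBeltrami (fun y ↦ v (y, s)) x - Q s x * v (x, s) + G s x := by
    intro x s hs
    have h := helper_classicalOfVeryWeak_noncompact n M g hg Q G hQ hG (Iio b) v isOpen_Iio hv hvweak (x, s)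
      ⟨mem_univ _, hs⟩
    simp only at h
    linarith
  -- `v = 0` on `M × (-∞, -2)`, where `u = 0`
  have hv0 : ∀ x, ∀ s < (-2 : ℝ), v (x, s) = 0 := by
    have hO : IsOpen ((univ : Set M) ×ˢ Iio (-2 : ℝ)) := isOpen_univ.prod isOpen_Iio
    have hsub : (univ : Set M) ×ˢ Iio (-2 : ℝ) ⊆ univ ×ˢ Iio b :=
      Set.prod_mono le_rfl (Iio_subset_Iio hab.le)
    have heq : EqOn v 0 ((univ : Set M) ×ˢ Iio (-2 : ℝ)) := by
      refine Measure.eqOn_open_of_ae_eq (μ := μ₀.prod (volume : Measure ℝ)) ?_ hO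
        (hv.mono hsub).continuousOn continuousOn_const
      rw [Filter.EventuallyEq, ae_restrict_iff' hO.measurableSet]
      filter_upwards [hae] with p hp hpO
      rw [← hp (hsub hpO), Pi.zero_apply]
      exact hu0 p fun h' ↦ lt_irrefl _ (h'.1.trans hpO.2)
    intro x s hs
    exact heq ⟨mem_univ _, hs⟩
  -- `v² ∈ L¹` of every strip inside `(-∞, b)` (`v = u` a.e., `u ∈ L²`)
  have hu2sq : Integrable (fun p : M × ℝ ↦ u p ^ 2) (μ₀.prod (volume : Measure ℝ)) := by
    have := hu2.integrable_norm_rpow two_ne_zero ENNReal.ofNat_ne_top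
    refine this.congr (Eventually.of_forall fun p ↦ ?_)
    simp [Real.norm_eq_abs, sq_abs]
  have hv2 : ∀ a' b' : ℝ, b' ≤ b → Integrable (fun p : M × ℝ ↦ v p ^ 2)
      ((μ₀.prod (volume : Measure ℝ)).restrict (univ ×ˢ Ioo a' b')) := by
    intro a' b' hb'
    refine (hu2sq.restrict (s := univ ×ˢ Ioo a' b')).congr ?_
    rw [Filter.EventuallyEq, ae_restrict_iff' (MeasurableSet.univ.prod measurableSet_Ioo)]
    filter_upwards [hae] with p hp hpS
    rw [hp ⟨mem_univ _, lt_of_lt_of_le hpS.2.2 hb'⟩]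
  /- `v = 0` on `M × [-3, 0]`: the weighted `L²` maximum principle for `z(r, x) = e^{V/2} e^{r} v(x, r − 3)`,
    which solves `∂ᵣz = Lz` on `[0, 3]` with `z(0) = 0` -/
  have hv00 : ∀ s ∈ Icc (-3 : ℝ) 0, ∀ x, v (x, s) = 0 := by
    -- the shifted open time set and the candidates `± z`
    set O : Set ℝ := Iio (b + 3) with hOdef
    have hO : IsOpen O := isOpen_Iio
    have hTO : Icc (0 : ℝ) 3 ⊆ O := fun r hr ↦ by simp only [hOdef, mem_Iio]; linarith [hr.2]
    have hshift : ContMDiff ((𝓡 n).prod 𝓘(ℝ, ℝ)) ((𝓡 n).prod 𝓘(ℝ, ℝ)) ∞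
        (fun p : M × ℝ ↦ ((p.1, p.2 - 3) : M × ℝ)) := contMDiff_fst.prodMk (contMDiff_snd.sub contMDiff_const)
    have hvs : ContMDiffOn ((𝓡 n).prod 𝓘(ℝ, ℝ)) 𝓘(ℝ, ℝ) ∞ (fun p : M × ℝ ↦ v (p.1, p.2 - 3)) (univ ×ˢ O) :=
      hv.comp hshift.contMDiffOn fun p hp ↦ ⟨mem_univ _, by
        have := hp.2; simp only [hOdef, mem_Iio] at this ⊢; linarith⟩
    have hE : ContMDiff ((𝓡 n).prod 𝓘(ℝ, ℝ)) 𝓘(ℝ, ℝ) ∞ (fun p : M × ℝ ↦ Real.exp (V p.1 / 2)) :=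
      ((contMDiff_iff_contDiff.2 Real.contDiff_exp).comp ((hV.comp contMDiff_fst).div_const 2))
    have hL : ContMDiff ((𝓡 n).prod 𝓘(ℝ, ℝ)) 𝓘(ℝ, ℝ) ∞ (fun p : M × ℝ ↦ Real.exp p.2) :=
      (contMDiff_iff_contDiff.2 Real.contDiff_exp).comp contMDiff_snd
    set z : ℝ → M → ℝ := fun r x ↦ Real.exp (V x / 2) * (Real.exp r * v (x, r - 3)) with hzdef
    have hzs : ContMDiffOn ((𝓡 n).prod 𝓘(ℝ, ℝ)) 𝓘(ℝ, ℝ) ∞ (fun p : M × ℝ ↦ z p.2 p.1) (univ ×ˢ O) :=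
      hE.contMDiffOn.mul (hL.contMDiffOn.mul hvs)
    have hnzs : ContMDiffOn ((𝓡 n).prod 𝓘(ℝ, ℝ)) 𝓘(ℝ, ℝ) ∞ (fun p : M × ℝ ↦ -z p.2 p.1) (univ ×ˢ O) := hzs.neg
    -- the equation for `z` on `[0, 3]`
    have hzeq : ∀ r ∈ Icc (0 : ℝ) 3, ∀ x, deriv (fun r' ↦ z r' x) r = g.dalembertian (z r) x
        - g.innerDual x (mvfderiv (𝓡 n) V x).toLinearMap (mvfderiv (𝓡 n) (z r) x).toLinearMap := by
      intro r hr x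
      have hsr : r - 3 < b := by linarith [hr.2]
      have h2le : (2 : ℕ∞ω) ≤ (∞ : ℕ∞ω) := by norm_cast
      -- the slice `y ↦ v(y, r - 3)` is smooth
      have hvsl : ContMDiff (𝓡 n) 𝓘(ℝ, ℝ) ∞ (fun y ↦ v (y, r - 3)) :=
        hv.comp_contMDiff (f := fun y : M ↦ ((y, r - 3) : M × ℝ)) (contMDiff_id.prodMk contMDiff_const)
          fun y ↦ ⟨mem_univ _, hsr⟩
      have hvs2 : ContMDiffAt (𝓡 n) 𝓘(ℝ, ℝ) 2 (fun y ↦ v (y, r - 3)) x := (hvsl.of_le h2le).contMDiffAt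
      -- the equation of `v` at time `r - 3 ≤ 0` (no forcing)
      have hdv : HasDerivAt (fun r' ↦ v (x, r' - 3))
          (g.dalembertian (fun y ↦ v (y, r - 3)) x - Q (r - 3) x * v (x, r - 3)) r := by
        have h1 : HasDerivAt (fun s ↦ v (x, s)) (deriv (fun s ↦ v (x, s)) (r - 3)) (r - 3) :=
          hasDerivAt_slice_of_contMDiffOn isOpen_Iio hv x hsr
        have h2 : HasDerivAt (fun r' : ℝ ↦ r' - 3) 1 r := by simpa using (hasDerivAt_id r).sub_const 3
        have h3 := h1.comp r h2
        rw [hclass x (r - 3) hsr, hG0 (r - 3) (by linarith [hr.2]) x, add_zero,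
          laplaceBeltrami_eq_dalembertian, mul_one] at h3
        exact h3
      -- the shifted function `w̃ = e^{r} v`
      set wt : ℝ → M → ℝ := fun r' y ↦ Real.exp r' * v (y, r' - 3) with hwtdef
      have hwt2 : ContMDiffAt (𝓡 n) 𝓘(ℝ, ℝ) 2 (wt r) x := (contMDiffAt_const.mul hvs2 :)
      have hdwt : HasDerivAt (fun r' ↦ wt r' x)
          (g.dalembertian (wt r) x - (g.gradSq V x / 4 - g.dalembertian V x / 2) * wt r x) r := by
        have h := (Real.hasDerivAt_exp r).mul hdv
        have hΔ : g.dalembertian (wt r) x = Real.exp r * g.dalembertian (fun y ↦ v (y, r - 3)) x := by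
          show g.dalembertian (fun y ↦ Real.exp r * v (y, r - 3)) x = _
          exact g.dalembertian_const_mul_of_contMDiffAt hvs2 _
        rw [hΔ]
        refine h.congr_deriv ?_
        simp only [hwtdef, hQdef]
        ring
      have hconj := heatDrift_of_potential g hV (S := univ) hwt2 hdwt.hasDerivWithinAt
      have hdz : HasDerivAt (fun r' ↦ z r' x)
          (g.dalembertian (z r) x - g.innerDual x (mvfderiv (𝓡 n) V x).toLinearMap
            (mvfderiv (𝓡 n) (z r) x).toLinearMap) r := by
        have h := hconj.hasDerivAt (Filter.univ_mem)
        simpa [hzdef, hwtdef] using h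
      exact hdz.deriv
    have hnzeq : ∀ r ∈ Icc (0 : ℝ) 3, ∀ x, deriv (fun r' ↦ -z r' x) r = g.dalembertian (fun y ↦ -z r y) x
        - g.innerDual x (mvfderiv (𝓡 n) V x).toLinearMap (mvfderiv (𝓡 n) (fun y ↦ -z r y) x).toLinearMap := by
      intro r hr x
      have hsr : r - 3 < b := by linarith [hr.2]
      have h2le : (2 : ℕ∞ω) ≤ (∞ : ℕ∞ω) := by norm_cast
      have hzsl : ContMDiff (𝓡 n) 𝓘(ℝ, ℝ) ∞ (z r) :=
        hzs.comp_contMDiff (f := fun y : M ↦ ((y, r) : M × ℝ)) (contMDiff_id.prodMk contMDiff_const)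
          fun y ↦ ⟨mem_univ _, hTO hr⟩
      have hz2 : ContMDiffAt (𝓡 n) 𝓘(ℝ, ℝ) 2 (z r) x := (hzsl.of_le h2le).contMDiffAt
      have haff := weightedLaplacian_affine (g := g) (V := V) hz2 (-1) 0
      have hdn : deriv (fun r' ↦ -z r' x) r = -deriv (fun r' ↦ z r' x) r :=
        (CutoffToolkit.hasDerivAt_time hO hzs x (hTO hr)).neg.deriv
      rw [hdn, hzeq r hr x]
      have e1 : (fun y ↦ -z r y) = fun y ↦ (-1) * z r y + 0 := funext fun y ↦ by ring
      rw [e1, haff]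
      ring
    -- the initial values vanish: `v(x, -3) = 0`
    have hz0 : ∀ x, z 0 x ≤ 0 := fun x ↦ by
      simp only [hzdef, hv0 x (0 - 3) (by norm_num), mul_zero, le_refl]
    have hnz0 : ∀ x, -z 0 x ≤ 0 := fun x ↦ by
      simp only [hzdef, hv0 x (0 - 3) (by norm_num), mul_zero, neg_zero, le_refl]
    -- integrability of `z₊² e^{-V}` and `(-z)₊² e^{-V}` on the strip `(0, 3)`: both are `≤ e^{6} v(x, r-3)²`
    have hvshift : Integrable (fun p : M × ℝ ↦ v (p.1, p.2 - 3) ^ 2)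
        ((μ₀.prod (volume : Measure ℝ)).restrict (univ ×ˢ Ioo 0 3)) := by
      have h := integrable_strip_comp_sub μ₀ (F := fun p : M × ℝ ↦ v p ^ 2) 3 (hv2 (-3) 0 hb.le)
      norm_num at h
      exact h
    have hmeasS : MeasurableSet ((univ : Set M) ×ˢ Ioo (0 : ℝ) 3) := MeasurableSet.univ.prod measurableSet_Ioo
    have hdom : ∀ {ζ : ℝ → M → ℝ}, (∀ r x, ζ r x = z r x ∨ ζ r x = -z r x) →
        ContMDiffOn ((𝓡 n).prod 𝓘(ℝ, ℝ)) 𝓘(ℝ, ℝ) ∞ (fun p : M × ℝ ↦ ζ p.2 p.1) (univ ×ˢ O) →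
        Integrable (fun p : M × ℝ ↦ max (ζ p.2 p.1) 0 ^ 2 * Real.exp (-V p.1))
          ((μ₀.prod (volume : Measure ℝ)).restrict (univ ×ˢ Ioo 0 3)) := by
      intro ζ hζ hζs
      refine (hvshift.const_mul (Real.exp 6)).mono' ?_ ?_
      · have h1 : ContinuousOn (fun p : M × ℝ ↦ ζ p.2 p.1) ((univ : Set M) ×ˢ Ioo (0 : ℝ) 3) :=
          hζs.continuousOn.mono (Set.prod_mono le_rfl fun r hr ↦ hTO (Ioo_subset_Icc_self hr))
        have h2 : ContinuousOn (fun p : M × ℝ ↦ max (ζ p.2 p.1) 0) ((univ : Set M) ×ˢ Ioo (0 : ℝ) 3) :=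
          (continuous_id.max continuous_const).comp_continuousOn h1
        have hc : ContinuousOn (fun p : M × ℝ ↦ max (ζ p.2 p.1) 0 ^ 2 * Real.exp (-V p.1))
            ((univ : Set M) ×ˢ Ioo (0 : ℝ) 3) :=
          (h2.pow 2).mul (Real.continuous_exp.comp (hV.continuous.comp continuous_fst).neg).continuousOn
        exact hc.aestronglyMeasurable hmeasS
      · rw [ae_restrict_iff' hmeasS]
        refine Eventually.of_forall fun p hp ↦ ?_
        obtain ⟨-, hr⟩ := hp
        have hsq : max (ζ p.2 p.1) 0 ^ 2 ≤ z p.2 p.1 ^ 2 := by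
          rcases hζ p.2 p.1 with h | h <;> rw [h]
          · rcases le_or_gt (z p.2 p.1) 0 with h' | h'
            · rw [max_eq_right h', zero_pow two_ne_zero]; exact sq_nonneg _
            · rw [max_eq_left h'.le]
          · rcases le_or_gt (-z p.2 p.1) 0 with h' | h'
            · rw [max_eq_right h', zero_pow two_ne_zero]; exact sq_nonneg _
            · rw [max_eq_left h'.le, neg_sq]
        have hE2 : Real.exp (V p.1 / 2) ^ 2 * Real.exp (-V p.1) = 1 := by
          rw [sq, ← Real.exp_add, ← Real.exp_add]
          convert Real.exp_zero using 2
          ring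
        have hz2 : z p.2 p.1 ^ 2 * Real.exp (-V p.1) = Real.exp p.2 ^ 2 * v (p.1, p.2 - 3) ^ 2 := by
          simp only [hzdef]
          calc (Real.exp (V p.1 / 2) * (Real.exp p.2 * v (p.1, p.2 - 3))) ^ 2 * Real.exp (-V p.1)
              = (Real.exp (V p.1 / 2) ^ 2 * Real.exp (-V p.1)) * (Real.exp p.2 ^ 2 * v (p.1, p.2 - 3) ^ 2) := by
                ring
            _ = _ := by rw [hE2, one_mul]
        have hexp : Real.exp p.2 ^ 2 ≤ Real.exp 6 := by
          rw [sq, ← Real.exp_add]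
          exact Real.exp_le_exp.2 (by linarith [hr.2])
        rw [Real.norm_eq_abs, abs_of_nonneg (mul_nonneg (sq_nonneg _) (Real.exp_pos _).le)]
        calc max (ζ p.2 p.1) 0 ^ 2 * Real.exp (-V p.1) ≤ z p.2 p.1 ^ 2 * Real.exp (-V p.1) :=
              mul_le_mul_of_nonneg_right hsq (Real.exp_pos _).le
          _ = Real.exp p.2 ^ 2 * v (p.1, p.2 - 3) ^ 2 := hz2
          _ ≤ Real.exp 6 * v (p.1, p.2 - 3) ^ 2 := mul_le_mul_of_nonneg_right hexp (sq_nonneg _)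
    have hintz := hdom (ζ := z) (fun r x ↦ Or.inl rfl) hzs
    have hintnz := hdom (ζ := fun r x ↦ -z r x) (fun r x ↦ Or.inr rfl) hnzs
    -- the maximum principle, twice
    have hle := gaffney_maxPrinciple hg hV hηs hηc hη01 hηmono hη1 hηgrad (T := 3) hO hTO hzs hzeq hz0 hintz
    have hge := gaffney_maxPrinciple hg hV hηs hηc hη01 hηmono hη1 hηgrad (T := 3) hO hTO hnzs hnzeq hnz0 hintnz
    intro s hs x
    have hr : s + 3 ∈ Icc (0 : ℝ) 3 := ⟨by linarith [hs.1], by linarith [hs.2]⟩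
    have hz : z (s + 3) x = 0 := le_antisymm (hle (s + 3) hr x) (by linarith [hge (s + 3) hr x])
    have hne : Real.exp (V x / 2) * Real.exp (s + 3) ≠ 0 := (mul_pos (Real.exp_pos _) (Real.exp_pos _)).ne'
    have h3 : s + 3 - 3 = s := by ring
    simp only [hzdef, h3] at hz
    have : Real.exp (V x / 2) * Real.exp (s + 3) * v (x, s) = 0 := by rw [mul_assoc]; exact hz
    rcases mul_eq_zero.1 this with h | h
    · exact absurd h hne
    · exact h
  refine ⟨v, hv, fun x s hs ↦ ?_, fun x s hs ↦ by rw [hclass x s hs], hv2 0 b le_rfl⟩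
  rcases lt_or_ge s (-2) with hs' | hs'
  · exact hv0 x s hs'
  · exact hv00 s ⟨by linarith, hs⟩ x

end Forcing

end Summit.SmoothPoincare4.SmoothPoincare4.Theorems.BakryEmeryComplete

end
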